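import Summits.SmoothPoincare4.SmoothPoincare4.Theses.SullivanDual
import Summits.SmoothPoincare4.SmoothPoincare4.Theorems.SullivanDualWitnessChargeReductionV18
import Summits.SmoothPoincare4.SmoothPoincare4.Theorems.SullivanDualNormalWitnessTransfer
import Summits.SmoothPoincare4.SmoothPoincare4.Theorems.SymplecticCapLocalFoliationEmbeddedSpheres

/-!
# `PencilLocalFamily` (stmt-SmoothPoincare4-16772) — closed

The SullivanDual crux `PencilLocalFamily` is, by the landed reduction
`WitnessCharge.PencilIncompleteness.helper_pencilLocalFamily_of_hls_nwt` (ReductionV18, p163600), a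
consequence of the two route items `LocalFoliationEmbeddedSpheres` (16778: the Hofer–Lizan–Sikorav local
foliation fact, now proved — `LocalFoliationEmbeddedSpheres_proof`, p173847) and `NormalWitnessTransfer`
(18059: `NormalWitnessTransfer_proof`, p170239).  This file applies it.

References: C. Wendl, *Holomorphic Curves in Low Dimensions* (2018), Prop. 2.53; M. Gromov, Invent. Math.
82 (1985), 2.4.A.  No definitions.
-/

-- the prescribed namespace `Summit.<P>.<Sub>.…` duplicates `SmoothPoincare4` (P = Sub)
set_option linter.dupNamespace false

namespace Summit.SmoothPoincare4.SmoothPoincare4.Theorems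

/-- **The SullivanDual route form of the local foliation fact** (the route decl is the Literature named
fact `hls_localFoliation_embeddedSphere_trivialNormal`, definitionally). -/
theorem SullivanDualLocalFoliationEmbeddedSpheres_proof :
    Summit.SmoothPoincare4.SmoothPoincare4.Theses.SullivanDual.LocalFoliationEmbeddedSpheres :=
  hls_localFoliation_embeddedSphere_trivialNormal_holds

/-- **`PencilLocalFamily` holds** (closes stmt-SmoothPoincare4-16772): the local foliation fact (16778)
and the normal-witness transfer (18059) fed to the landed reduction
`helper_pencilLocalFamily_of_hls_nwt`. -/
theorem PencilLocalFamily_proof :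
    Summit.SmoothPoincare4.SmoothPoincare4.Theses.SullivanDual.PencilLocalFamily :=
  WitnessCharge.PencilIncompleteness.helper_pencilLocalFamily_of_hls_nwt
    SullivanDualLocalFoliationEmbeddedSpheres_proof NormalWitnessTransfer_proof

end Summit.SmoothPoincare4.SmoothPoincare4.Theorems
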